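import Summits.BirchSwinnertonDyer.BirchSwinnertonDyer.Theorems.UniversalToricDescentTwinWanFrameAtThreeMultTresTAllSplitSelfDual
import Summits.BirchSwinnertonDyer.BirchSwinnertonDyer.Theorems.UniversalToricDescentRoadFFCpIntMemberTowerSelfDual
import Summits.BirchSwinnertonDyer.BirchSwinnertonDyer.Theorems.ErratumRoadFiveSelfDualMemberInputs
import Summits.BirchSwinnertonDyer.BirchSwinnertonDyer.Theorems.ErratumRoadFiveErratumThm23DecOfTwoVarCore
import Summits.BirchSwinnertonDyer.BirchSwinnertonDyer.Theorems.ErratumRoadFiveIMCDivMemberDivisibleMember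
import HarnessLib

/-!
# Route `UniversalToricDescent`, ♭B′ `TwinWanFrameAtThreeMultTresT` (stmt-BirchSwinnertonDyer-27401) / K1-at-3 re-keyed on the erratum's
# SELF-DUAL module (27934 → K1♯†, pen PEN-RULING-27934-v1): the TWO-VARIABLE road TV₃† ⟹ K1♯ᵈ† at `p = 3`, and ♭B′ BY NAME from
# Hsieh Thm B + the weight-sharpened all-split member/frame statement + K1♯ᵈ†

Width seat bsd-wall-utd-p2-w2 g9 (2026-08-28), `--supports stmt-BirchSwinnertonDyer-27401` (helper) — p655790 (this lineage, g8) RE-RUN on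
`A^†_{g_m}`. Theorems only (no definition, no named fact, no `sorry`).

WHY. The vet (bsd-vet-utdR2 g3–g7) RETURNED K1-at-3 as typed: its member module `XBig κ (D.Δ.cofreeRepOver K) 𝔭′ Σ` is the Greenberg dual of the
UNTWISTED lattice (`det = ε^{k−1}`), whereas the erratum's `A_g` is the self-dual Tate twist ([Castella2018Erratum] §2 p. 2; tree
`D.Δ.selfDualRep = Δ.ρ ⊗ ε^{1−k/2}`, p657158) — and the same holds for this lineage's K1♯ / K1♯ᵈ / TV₃ (p652359, p655790). The repair keys every
member-level statement on `D.Δ.selfDualCofreeRepOver K` under the weight clause `2(p−1)p^{m−1} ∣ k_m − 2` (= `4·3^{m−1} ∣ k_m − 2`, spelled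
`(2 * (((3 : ℕ) : ℤ) - 1) * ((3 : ℕ) : ℤ) ^ (m - 1)) ∣ D.k - 2` as in the pen's K1♯† v2 fc46e6da7466964a), which is what makes
`A^†_{g_m}[3^m] ≅ W′[3^m] ⊗ 𝒪_m` (bsd-stepL (b†) p658384) and is a free choice of weight in print ([Skinner2016PacificMC] §2.6; supply† p661053).

* §1† `sharpDecDagger_of_twoVarCoreAtThreeDagger : TV₃† → K1♯ᵈ†` — TV₃† = TV₃ (two-variable Σ-imprimitive core at the member data, pinned on
  `T_c = 0` to the BDP frame) with the weight binder on the module `AnticyclotomicBigGaloisRep κ (D.Δ.selfDualCofreeRepOver K)`; K1♯ᵈ† = K1♯† +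
  the (dec)† binder. Proof = p655790 §1 with (glob)† from the item's own `HasSurjectiveModNGaloisRep 3` through (b†)
  (`SelfDualTwist.forall_fixed_primary_eq_zero_selfDual`, bsd-stepL p659402; vet g6: no extra binder), (unr)†
  `SelfDualTwist.selfDualCofreeRepOver_localMap_inr_apply_eq_self`, `SkinnerUrban2014.moduleFinite_XBig_of_lemma319`, and the generic
  `ControlAt.exists_controlMap` / `TwoVariableDescent.*` (exact two-variable control, cyclotomic `κ′`, determinant trick, descent along `T_c ↦ 0`).
* §2† `twinWanFrameAtThreeMultTresT_of_thmB_of_allSplitMembersFramesWt_of_decSelfDualMemberRationalInclusion` — ♭B′ BY NAME from Hsieh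
  Thm B, `C_min†` (inline: p645093's `C_min` + the weight conjunct, = supply† `…_odd_nonsplit_wt` over an all-split `K`) and K1♯ᵈ†: the LINE
  NEEDS ONLY K1♯ᵈ†, because ♭B′'s très-ramifié binder gives (dec) for the twin (`twin_dec_of_forall_not_cube`) and (b†) transports it to every
  member satisfying the weight clause; the tower is the self-dual one (`twin_exists_forall_C_pow_mul_mem_span_of_cpIntMemberTower_selfDual_of_isTorsion`,
  p660828). 
* §3† `twinWanFrameAtThreeMultTresT_of_thmB_of_nonsplitWtMembersFrames_of_twoVarCoreAtThreeDagger` — ♭B′ BY NAME from Hsieh Thm B,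
  the supply† BY NAME (item 23284) and TV₃†: §2† ∘ the lead's `…AllSplitSelfDual.allSplitWtMembersFrames_of_nonsplitWtMembersFrames` ∘ §1†
  (the composition for a skeleton v16 with research stub := TV₃†).

READING. Research residue = TV₃† alone (two-variable Σ-imprimitive Greenberg-side divisibility for the SELF-DUAL lattice of a `3`-ordinary
newform of weight `k ≡ 2 (mod 4·3^{m−1})` congruent to the twin, over the `ℤ₃²`-extension of an all-split `K`, pinned to the BDP frame; no engine
in print at `p = 3`). Items closed 0; classes closed 0; BSD is proved for no curve.

References: [Castella2018Erratum] §2 (p. 2), L. 2.1, (2.4)–(2.5), proof of Thm. 1.1 (a)(b)(c); [JetchevSkinnerWan2017] §3.4, L. 3.4.1, Cor. 3.4.2;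
[Skinner2016PacificMC] §2.6, §3.1 (a)(b); [Hsieh2014] Thm. B; [Castella2020JIMJ] Thm. 2.11; [FouquetWan2021] Thm. 4.41; [YanZhu2026] Thm. 4.4, 4.7. -/

noncomputable section

open scoped Classical

set_option linter.dupNamespace false
set_option autoImplicit false

namespace Summit.BirchSwinnertonDyer.BirchSwinnertonDyer.Theorems.UniversalToricDescentTwinMemberRationalInclusionAtThreeOfTwoVarCoreSelfDual

open PowerSeries WeierstrassCurve NumberField IsDedekindDomain Field
  Literature.NumberTheory.EllipticCurves
  Literature.NumberTheory.EllipticCurves.ModularForms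
  Literature.NumberTheory.EllipticCurves.Rank1Residual
  Literature.NumberTheory.EllipticCurves.BigGaloisRep
  Literature.NumberTheory.EllipticCurves.GreenbergSelmer
  Literature.NumberTheory.GaloisRepresentations
  Summit.BirchSwinnertonDyer.Rank1Residual.X11b
  Summit.BirchSwinnertonDyer.Rank1Residual.X11b.Halves
  Summit.BirchSwinnertonDyer.BirchSwinnertonDyer.Theorems.SchneiderFree
  Summit.BirchSwinnertonDyer.BirchSwinnertonDyer.Theorems.UniversalToricDescentTwinTorsionRankOne
  Summit.BirchSwinnertonDyer.BirchSwinnertonDyer.Theorems.UniversalToricDescentTwinDecLocus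
  Summit.BirchSwinnertonDyer.BirchSwinnertonDyer.Theorems.ErratumThm23TwoVariable
  Summit.BirchSwinnertonDyer.BirchSwinnertonDyer.Theses.UniversalToricDescent
  Summit.BirchSwinnertonDyer.BirchSwinnertonDyer.Theorems

/-! ## §1† K1♯ᵈ† from the two-variable core at `p = 3` (self-dual module) -/

set_option maxHeartbeats 800000 in
-- statement-sized packages over the iterated big representation (as bsd-stepL's p634294); the proof is glue
/-- **K1♯ᵈ† ⟸ TV₃†** (self-dual module, weight clause). The hypothesis `hTV` is the two-variable core at the member data of K1♯†
(module `AnticyclotomicBigGaloisRep κ (D.Δ.selfDualCofreeRepOver K)`); the conclusion is K1♯† (pen text v2) with the single extra binder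
(dec)† after `IsResiduallyIrreducible D.Δ →`. Proof: p655790 §1 on `A^†` — (glob)† from `ρ̄₃` onto through (b†), (unr)† (`ε` unramified
away from `3`), `X^Σ_ac(A^†_g)` finitely generated (Lemma 3.1.9 form), EXACT two-variable control, a cyclotomic `κ′`, two-variable torsion,
descent of `Ch` along `T_c ↦ 0`, exponent `e = 0`. [cite: JetchevSkinnerWan2017, §3.4, Lemma 3.4.1 and Cor. 3.4.2 (arXiv:1512.06894 p. 14)]
[cite: Castella2018Erratum, §2 (p. 2), Lemma 2.1 and proof of Thm. 2.3, (2.4) ⇒ (2.5) (p. 4)] [cite: Skinner2016PacificMC, §2.6 (weight choice), §3.1 (b)] -/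
theorem sharpDecDagger_of_twoVarCoreAtThreeDagger
    (hTV :
    ∀ (W' : WeierstrassCurve ℚ) [W'.IsElliptic] [W'.IsGloballyMinimal] (N' : ℕ) [NeZero N']
      (K : Type) [Field K] [NumberField K] (Dt' : ModularParametrizationData W' N'),
      Mult W' 3 → W'.HasSurjectiveModNGaloisRep 3 → W'.conductorNorm ℤ = N' → IsImaginaryQuadratic K →
      SatisfiesHeegnerHypothesis N' K → Odd (NumberField.discr K) →
      ∀ (κ : ZpExtension K 3), κ.IsAnticyclotomic → ∀ (γ : absoluteGaloisGroup K) [Fact (κ.IsTopGenerator γ)]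
        (𝔭 : HeightOneSpectrum (𝓞 K)), ((3 : ℕ) : 𝓞 K) ∈ 𝔭.asIdeal →
        𝔭.asIdeal.ramificationIdx (𝓞 ℚ) = 1 → 𝔭.asIdeal.inertiaDeg (𝓞 ℚ) = 1 →
        ∀ (𝔭' : HeightOneSpectrum (𝓞 K)), ((3 : ℕ) : 𝓞 K) ∈ 𝔭'.asIdeal → 𝔭' ≠ 𝔭 →
        ∀ (ι' : PadicAlgCl 3 ≃+* ℂ), BranchInducesPrime 3 ι' 𝔭 →
        ∀ (m : ℕ), 1 ≤ m → ∀ (D : Skinner2016.HidaCongruentMember W' 3 m),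
          (2 * (((3 : ℕ) : ℤ) - 1) * ((3 : ℕ) : ℤ) ^ (m - 1)) ∣ D.k - 2 →
          SkinnerUrban2014.IsResiduallyIrreducible D.Δ →
          (∀ a : Cofree D.Δ.selfDualRep (padicCoeffField D.ι),
              (∀ σ : LocalGroup K (Sum.inl 𝔭'), (D.Δ.selfDualCofreeRepOver K) (localMap K (Sum.inl 𝔭') σ) a = a) →
              (∃ j : ℕ, (3 : ℕ) ^ j • a = 0) → a = 0) →
          (∀ x : coeffField D.g, ι' (D.ι x) = (x : ℂ)) →
        ∀ (b : padicCoeffIntegers D.ι →+* 𝓞_ℂ_[3]),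
          (∀ x, ((b x : 𝓞_ℂ_[3]) : ℂ_[3]) = algebraMap (PadicAlgCl 3) ℂ_[3] (padicCoeffIntegers.toPadicAlgCl D.ι x)) →
        ∀ (ΩK : ℂ) (Ωp : (𝓞_ℂ_[3])ˣ) (Q : PowerSeries 𝓞_ℂ_[3]), ΩK ≠ 0 →
          IsBDPLFunctionWtSigmaInt ι' 𝔭 κ γ D.g (W'.sigmaPlacesFinset 3 K) ΩK ((Ωp : 𝓞_ℂ_[3]) : ℂ_[3]) Q →
        ∀ (κ' : ZpExtension K 3) (γ' : absoluteGaloisGroup K) [Fact (κ'.IsTopGenerator γ')], κ'.IsCyclotomic →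
        ∀ [TopologicalSpace (PowerSeries (padicCoeffIntegers D.ι))]
          [TopologicalSpace (PowerSeries (PowerSeries (padicCoeffIntegers D.ι)))]
          [ContinuousSMul (PowerSeries (PowerSeries (padicCoeffIntegers D.ι)))
            (BigRepModule (PowerSeries (padicCoeffIntegers D.ι)) 3
              (BigRepModule (padicCoeffIntegers D.ι) 3 (Cofree D.Δ.selfDualRep (padicCoeffField D.ι))))],
          Module.IsTorsion (PowerSeries (PowerSeries (padicCoeffIntegers D.ι)))
              (XBig κ' (AnticyclotomicBigGaloisRep κ (D.Δ.selfDualCofreeRepOver K)) 𝔭' (↑(W'.sigmaPlacesFinset 3 K))) →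
            ∃ Q₂ : PowerSeries (PowerSeries 𝓞_ℂ_[3]),
              (∃ u : (PowerSeries 𝓞_ℂ_[3])ˣ, PowerSeries.constantCoeff Q₂ = (u : PowerSeries 𝓞_ℂ_[3]) * Q) ∧
              (XBig.charIdeal κ' (AnticyclotomicBigGaloisRep κ (D.Δ.selfDualCofreeRepOver K)) 𝔭'
                  (↑(W'.sigmaPlacesFinset 3 K))).map (PowerSeries.map (PowerSeries.map b)) ≤ Ideal.span {Q₂}) :
    ∀ (W' : WeierstrassCurve ℚ) [W'.IsElliptic] [W'.IsGloballyMinimal] (N' : ℕ) [NeZero N']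
      (K : Type) [Field K] [NumberField K] (Dt' : ModularParametrizationData W' N'),
      Mult W' 3 → W'.HasSurjectiveModNGaloisRep 3 → W'.conductorNorm ℤ = N' → IsImaginaryQuadratic K →
      SatisfiesHeegnerHypothesis N' K → Odd (NumberField.discr K) →
      ∀ (κ : ZpExtension K 3), κ.IsAnticyclotomic → ∀ (γ : absoluteGaloisGroup K) [Fact (κ.IsTopGenerator γ)]
        (𝔭 : HeightOneSpectrum (𝓞 K)), ((3 : ℕ) : 𝓞 K) ∈ 𝔭.asIdeal →
        𝔭.asIdeal.ramificationIdx (𝓞 ℚ) = 1 → 𝔭.asIdeal.inertiaDeg (𝓞 ℚ) = 1 →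
        ∀ (𝔭' : HeightOneSpectrum (𝓞 K)), ((3 : ℕ) : 𝓞 K) ∈ 𝔭'.asIdeal → 𝔭' ≠ 𝔭 →
        ∀ (ι' : PadicAlgCl 3 ≃+* ℂ), BranchInducesPrime 3 ι' 𝔭 →
        ∀ (m : ℕ), 1 ≤ m → ∀ (D : Skinner2016.HidaCongruentMember W' 3 m),
          (2 * (((3 : ℕ) : ℤ) - 1) * ((3 : ℕ) : ℤ) ^ (m - 1)) ∣ D.k - 2 →
          SkinnerUrban2014.IsResiduallyIrreducible D.Δ →
          (∀ a : Cofree D.Δ.selfDualRep (padicCoeffField D.ι),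
              (∀ σ : LocalGroup K (Sum.inl 𝔭'), (D.Δ.selfDualCofreeRepOver K) (localMap K (Sum.inl 𝔭') σ) a = a) →
              (∃ j : ℕ, (3 : ℕ) ^ j • a = 0) → a = 0) →
          (∀ x : coeffField D.g, ι' (D.ι x) = (x : ℂ)) →
        ∀ (b : padicCoeffIntegers D.ι →+* 𝓞_ℂ_[3]),
          (∀ x, ((b x : 𝓞_ℂ_[3]) : ℂ_[3]) = algebraMap (PadicAlgCl 3) ℂ_[3] (padicCoeffIntegers.toPadicAlgCl D.ι x)) →
        ∀ (ΩK : ℂ) (Ωp : (𝓞_ℂ_[3])ˣ) (Q : PowerSeries 𝓞_ℂ_[3]), ΩK ≠ 0 →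
          IsBDPLFunctionWtSigmaInt ι' 𝔭 κ γ D.g (W'.sigmaPlacesFinset 3 K) ΩK ((Ωp : 𝓞_ℂ_[3]) : ℂ_[3]) Q →
        ∀ [TopologicalSpace (PowerSeries (padicCoeffIntegers D.ι))]
          [ContinuousSMul (PowerSeries (padicCoeffIntegers D.ι))
            (BigRepModule (padicCoeffIntegers D.ι) 3 (Cofree D.Δ.selfDualRep (padicCoeffField D.ι)))],
          Module.IsTorsion (PowerSeries (padicCoeffIntegers D.ι))
              (XBig κ (D.Δ.selfDualCofreeRepOver K) 𝔭' (↑(W'.sigmaPlacesFinset 3 K))) →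
            ∃ e : ℕ, Ideal.span {(PowerSeries.C ((3 : ℕ) : 𝓞_ℂ_[3]) : PowerSeries 𝓞_ℂ_[3]) ^ e} *
                (XBig.charIdeal κ (D.Δ.selfDualCofreeRepOver K) 𝔭' (↑(W'.sigmaPlacesFinset 3 K))).map (PowerSeries.map b) ≤
              Ideal.span {Q} := by
  intro W' _ _ N' _ K _ _ Dt' hmult hsurj hN' hK hH hodd κ hκ γ _ 𝔭 h𝔭 he hf 𝔭' h𝔭' hne ι' hι' m hm D hk hirr hdec hι b hb
    ΩK Ωp Q hΩK hQ _i1 _i2 hT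
  -- ### level bookkeeping: `3 ∣ N′`, `3 ∤ N′/3`, `N′/3 ≠ 0`
  have hpN : 3 ∣ W'.conductorNorm ℤ := dvd_conductorNorm_of_mult hmult
  have hN0 : W'.conductorNorm ℤ ≠ 0 := (W'.conductorNorm_pos_holds).ne'
  have hpM : ¬ 3 ∣ W'.conductorNorm ℤ / 3 := by
    have hfac := W'.factorization_conductorNorm_eq_one_of_hasMultiplicativeReductionAtPrime 3 hmult
    intro h
    have h2 : 3 ^ 2 ∣ W'.conductorNorm ℤ := by
      rw [pow_two]
      exact Nat.mul_dvd_of_dvd_div hpN h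
    have := ((Fact.out : (3 : ℕ).Prime).pow_dvd_iff_le_factorization hN0).mp h2
    omega
  haveI : NeZero (W'.conductorNorm ℤ / 3) :=
    ⟨(Nat.div_pos (Nat.le_of_dvd (Nat.pos_of_ne_zero hN0) hpN) (by norm_num)).ne'⟩
  -- ### `Σ` contains every place dividing the tame level `N′/3`
  have hSM : ∀ w : HeightOneSpectrum (𝓞 K), w ∉ (↑(W'.sigmaPlacesFinset 3 K) : Set (HeightOneSpectrum (𝓞 K))) →
      ((W'.conductorNorm ℤ / 3 : ℕ) : 𝓞 K) ∉ w.asIdeal := by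
    intro w hw hM'
    rw [WeierstrassCurve.coe_sigmaPlacesFinset] at hw
    exact hw (WeierstrassCurve.mem_sigmaPlaces_of_tameLevel_mem hpN hpM hM')
  -- ### (glob)† from the twin's `ρ̄₃` onto (`W′[3]` irreducible, no `Γ_K`-fixed geometric `3`-torsion), through (b†)
  have hirrW : Irr W' 3 := hasIrreducibleModPGaloisRep_of_hasSurjectiveModNGaloisRep W' 3 hsurj
  haveI := D.moduleFree_coeffRing
  have hglob : ∀ a : Cofree D.Δ.selfDualRep (padicCoeffField D.ι),
      (∀ σ : absoluteGaloisGroup K, (D.Δ.selfDualCofreeRepOver K) σ a = a) → (∃ j : ℕ, (3 : ℕ) ^ j • a = 0) → a = 0 :=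
    SelfDualTwist.forall_fixed_primary_eq_zero_selfDual D K hm hk (fun σ : absoluteGaloisGroup K => σ)
      (BigRep.hglob_geomPoints_of_irr W' 3 hK hirrW)
  -- ### (unr)† outside `Σ ∪ {v ∣ 3}` (`ε` is unramified away from `3`)
  have hunr := SelfDualTwist.selfDualCofreeRepOver_localMap_inr_apply_eq_self D.Δ K
    (↑(W'.sigmaPlacesFinset 3 K) : Set (HeightOneSpectrum (𝓞 K))) hSM
  -- ### a cyclotomic `ℤ₃`-extension with a topological generator; the discrete topology on `Λ_K`
  obtain ⟨κ', hκ'⟩ := Literature.NumberTheory.EllipticCurves.exists_cyclotomicZpExtension_holds K 3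
  obtain ⟨γ', hγ'⟩ := κ'.surjective (Multiplicative.ofAdd 1)
  haveI : Fact (κ'.IsTopGenerator γ') := ⟨hγ'⟩
  letI : TopologicalSpace (PowerSeries (PowerSeries (padicCoeffIntegers D.ι))) := ⊥
  haveI : DiscreteTopology (PowerSeries (PowerSeries (padicCoeffIntegers D.ι))) := ⟨rfl⟩
  -- ### finite generation of `X^Σ_ac(A_g)` and of the two-variable dual; the EXACT control map
  haveI := D.finiteDimensional_padicCoeffField
  haveI : Module.Finite (PowerSeries (padicCoeffIntegers D.ι))
      (XBig κ (D.Δ.selfDualCofreeRepOver K) 𝔭' (↑(W'.sigmaPlacesFinset 3 K) : Set (HeightOneSpectrum (𝓞 K)))) :=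
    SkinnerUrban2014.moduleFinite_XBig_of_lemma319 SkinnerUrban2014.lemma319_finite_XBig_holds κ 𝔭' _
      (W'.sigmaPlacesFinset 3 K).finite_toSet (D.Δ.selfDualCofreeRepOver K)
      (GreenbergSelmer.Cofree.exists_pow_psmul_eq_zero D.ι D.Δ.selfDualRep)
      (GreenbergSelmer.Cofree.divisible (padicCoeffField D.ι) D.Δ.selfDualRep (Fact.out : (3 : ℕ).Prime).ne_zero)
      (GreenbergSelmer.Cofree.finite_setOf_psmul_eq_zero D.ι D.Δ.selfDualRep) hunr
  haveI := ControlAt.module_finite_XBig_iterate κ κ' (D.Δ.selfDualCofreeRepOver K) 𝔭'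
    (↑(W'.sigmaPlacesFinset 3 K) : Set (HeightOneSpectrum (𝓞 K))) hglob hdec hunr
  have key := ControlAt.exists_controlMap κ κ' (D.Δ.selfDualCofreeRepOver K) 𝔭'
    (↑(W'.sigmaPlacesFinset 3 K) : Set (HeightOneSpectrum (𝓞 K))) hglob hdec hunr
  -- ### ring-theoretic clauses for the member's coefficient ring
  haveI : IsPrincipalIdealRing (padicCoeffIntegers D.ι) := D.isPrincipalIdealRing_coeffRing
  haveI : UniqueFactorizationMonoid (PowerSeries (PowerSeries (padicCoeffIntegers D.ι))) :=
    CoeffRing.uniqueFactorizationMonoid_powerSeries_powerSeries D.ι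
  -- ### two-variable torsion from the one-variable torsion premise + control (determinant trick)
  have hs := TwoVariableDescent.exists_constantCoeff_ne_zero_of_control
    (A := PowerSeries (padicCoeffIntegers D.ι))
    (XBig κ' (AnticyclotomicBigGaloisRep κ (D.Δ.selfDualCofreeRepOver K)) 𝔭'
      (↑(W'.sigmaPlacesFinset 3 K) : Set (HeightOneSpectrum (𝓞 K))))
    (XBig κ (D.Δ.selfDualCofreeRepOver K) 𝔭' (↑(W'.sigmaPlacesFinset 3 K) : Set (HeightOneSpectrum (𝓞 K))))
    hT key.choose key.choose_spec.2.2
  have htors₂ := TwoVariableDescent.isTorsion_of_exists_constantCoeff_ne_zero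
    (A := PowerSeries (padicCoeffIntegers D.ι))
    (XBig κ' (AnticyclotomicBigGaloisRep κ (D.Δ.selfDualCofreeRepOver K)) 𝔭'
      (↑(W'.sigmaPlacesFinset 3 K) : Set (HeightOneSpectrum (𝓞 K)))) hs
  -- ### the two-variable core at this member, for this cyclotomic `κ′`
  obtain ⟨Q₂, ⟨u, hu⟩, hle⟩ := hTV W' N' K Dt' hmult hsurj hN' hK hH hodd κ hκ γ 𝔭 h𝔭 he hf 𝔭' h𝔭' hne ι' hι'
    m hm D hk hirr hdec hι b hb ΩK Ωp Q hΩK hQ κ' γ' hκ' htors₂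
  -- ### descent of the characteristic ideal along `T_c ↦ 0` (JSW Cor. 3.4.2, kernel form), read in `𝓞_{ℂ₃}`
  have hdesc := TwoVariableDescent.charIdeal_le_map_constantCoeff_of_control
    (A := PowerSeries (padicCoeffIntegers D.ι))
    (XBig κ' (AnticyclotomicBigGaloisRep κ (D.Δ.selfDualCofreeRepOver K)) 𝔭'
      (↑(W'.sigmaPlacesFinset 3 K) : Set (HeightOneSpectrum (𝓞 K))))
    (XBig κ (D.Δ.selfDualCofreeRepOver K) 𝔭' (↑(W'.sigmaPlacesFinset 3 K) : Set (HeightOneSpectrum (𝓞 K))))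
    hT key.choose key.choose_spec.1 key.choose_spec.2.2
  refine ⟨0, ?_⟩
  rw [pow_zero, Ideal.span_singleton_one, Ideal.top_mul]
  refine (Ideal.map_mono hdesc).trans ?_
  rw [TwoVariableDescent.map_map_constantCoeff_eq b]
  exact TwoVariableDescent.map_constantCoeff_le_span_of_le_span_of_eq_unit_mul hle hu

/-! ## §2† The line needs only K1♯ᵈ†: ♭B′ from Hsieh Thm B + `C_min†` + K1♯ᵈ† -/

set_option maxHeartbeats 800000 in
/-- **♭B′ `TwinWanFrameAtThreeMultTresT` (stmt-BirchSwinnertonDyer-27401) BY NAME from Hsieh Thm B + `C_min†` (inline: the consumer-minimal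
odd-`p` member/frame statement over an all-split `K` WITH the weight conjunct `2(p−1)p^{m−1} ∣ k_m − 2` first under `∃ D Qm`) + K1♯ᵈ†** (K1♯† v2
with the extra binder (dec)† on `D.Δ.selfDualCofreeRepOver K`). p655790 §2 on `A^†`: (dec) for the twin from the très-ramifié binder
(`twin_dec_of_forall_not_cube`: `W′(ℚ₃)[3] = 0`), `K_𝔭′ → ℚ₃` at the degree-one prime `𝔭′`, no `Γ_{K_𝔭′}`-fixed geometric `3`-torsion
(`BigRep.hdec_geomPoints_of_padicTorsion`), transported to `A^†_{g_m}` through (b†) under the weight clause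
(`SelfDualTwist.forall_fixed_primary_eq_zero_selfDual`); then the SELF-DUAL member tower (p660828). CONDITIONAL on {Hsieh Thm B PUBLISHED,
`C_min†` PUBLISHED reading, K1♯ᵈ† RESEARCH}; nothing is booked; BSD is proved for no curve.
[cite: Hsieh2014, Thm. B p. 712] [cite: Castella2020JIMJ, §2 Def. 2.10, Thm. 2.11] [cite: Skinner2016PacificMC, §2.6 (2-6-1), §3.1 (a)(b) (p. 192)]
[cite: Castella2018Erratum, §2 (p. 2), Thm. 1.1 (iv), Lemma 2.1 (pp. 1–2)] -/
theorem twinWanFrameAtThreeMultTresT_of_thmB_of_allSplitMembersFramesWt_of_decSelfDualMemberRationalInclusion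
    (hB : Hsieh2014.thmB_exists_isHsiehLFunction_coeff_norm_eq_one_unrPeriod_anyLevel)
    (hC : ∀ {p : ℕ} [Fact p.Prime] (ι : PadicAlgCl p ≃+* ℂ) (W : WeierstrassCurve ℚ) [W.IsElliptic]
      [W.IsGloballyMinimal] (K : Type) [Field K] [NumberField K]
      (𝔭 : HeightOneSpectrum (𝓞 K)) (κ : ZpExtension K p) (γ : absoluteGaloisGroup K)
      [Fact (κ.IsTopGenerator γ)] {N : ℕ} [NeZero N] {f : CuspForm (CongruenceSubgroup.Gamma0 N) 2}
      (_ : IsNewformOf W f),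
      W.conductorNorm ℤ = N → p ≠ 2 → Mult W p → 3 ≤ N / p → Irr W p →
      IsImaginaryQuadratic K → Odd (NumberField.discr K) → SatisfiesHeegnerHypothesis N K →
      ((Ideal.span {(p : ℤ)}).primesOver (𝓞 K)).ncard = 2 →
      ((p : ℕ) : 𝓞 K) ∈ 𝔭.asIdeal →
      (∀ (w : InfinitePlace K) (x : 𝓞 K), x ∈ 𝔭.asIdeal ↔ ‖ι.symm (w.embedding (x : K))‖ < 1) →
      κ.IsAnticyclotomic →
      ∀ (a : unrIntegers p →+* PadicComplexInt p) (j : ℤ_[p] →+* unrIntegers p),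
        (∀ x : unrIntegers p, ((a x : PadicComplexInt p) : ℂ_[p]) = (x : ℂ_[p])) →
        (∀ x : ℤ_[p], ((j x : unrIntegers p) : ℂ_[p]) = algebraMap ℚ_[p] ℂ_[p] (x : ℚ_[p])) →
      ∃ (ΩK : ℂ) (Ωp : (unrIntegers p)ˣ) (L : UnrSeries p),
        ΩK ≠ 0 ∧ IsBDPLFunction ι 𝔭 κ γ f ΩK ((Ωp : unrIntegers p) : ℂ_[p]) L ∧
        ∀ m : ℕ, 1 ≤ m →
          ∃ (D : Skinner2016.HidaCongruentMember W p m) (Qm : PowerSeries (PadicComplexInt p)),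
            (2 * ((p : ℤ) - 1) * (p : ℤ) ^ (m - 1)) ∣ D.k - 2 ∧
            (∀ x : coeffField D.g, ι (D.ι x) = (x : ℂ)) ∧
            SkinnerUrban2014.IsResiduallyIrreducible D.Δ ∧
            IsBDPLFunctionWtSigmaInt ι 𝔭 κ γ D.g (W.sigmaPlacesFinset p K) ΩK ((Ωp : unrIntegers p) : ℂ_[p]) Qm ∧
            Ideal.span {Qm} ⊔ Ideal.span {(PowerSeries.C (((p : ℕ) : PadicComplexInt p) ^ m))} =
              Ideal.span {PowerSeries.map a (L * PowerSeries.map j (W.sigmaEulerElement p K κ))} ⊔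
                Ideal.span {(PowerSeries.C (((p : ℕ) : PadicComplexInt p) ^ m))})
    (hK1 :
    ∀ (W' : WeierstrassCurve ℚ) [W'.IsElliptic] [W'.IsGloballyMinimal] (N' : ℕ) [NeZero N']
      (K : Type) [Field K] [NumberField K] (Dt' : ModularParametrizationData W' N'),
      Mult W' 3 → W'.HasSurjectiveModNGaloisRep 3 → W'.conductorNorm ℤ = N' → IsImaginaryQuadratic K →
      SatisfiesHeegnerHypothesis N' K → Odd (NumberField.discr K) →
      ∀ (κ : ZpExtension K 3), κ.IsAnticyclotomic → ∀ (γ : absoluteGaloisGroup K) [Fact (κ.IsTopGenerator γ)]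
        (𝔭 : HeightOneSpectrum (𝓞 K)), ((3 : ℕ) : 𝓞 K) ∈ 𝔭.asIdeal →
        𝔭.asIdeal.ramificationIdx (𝓞 ℚ) = 1 → 𝔭.asIdeal.inertiaDeg (𝓞 ℚ) = 1 →
        ∀ (𝔭' : HeightOneSpectrum (𝓞 K)), ((3 : ℕ) : 𝓞 K) ∈ 𝔭'.asIdeal → 𝔭' ≠ 𝔭 →
        ∀ (ι' : PadicAlgCl 3 ≃+* ℂ), BranchInducesPrime 3 ι' 𝔭 →
        ∀ (m : ℕ), 1 ≤ m → ∀ (D : Skinner2016.HidaCongruentMember W' 3 m),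
          (2 * (((3 : ℕ) : ℤ) - 1) * ((3 : ℕ) : ℤ) ^ (m - 1)) ∣ D.k - 2 →
          SkinnerUrban2014.IsResiduallyIrreducible D.Δ →
          (∀ a : Cofree D.Δ.selfDualRep (padicCoeffField D.ι),
              (∀ σ : LocalGroup K (Sum.inl 𝔭'), (D.Δ.selfDualCofreeRepOver K) (localMap K (Sum.inl 𝔭') σ) a = a) →
              (∃ j : ℕ, (3 : ℕ) ^ j • a = 0) → a = 0) →
          (∀ x : coeffField D.g, ι' (D.ι x) = (x : ℂ)) →
        ∀ (b : padicCoeffIntegers D.ι →+* 𝓞_ℂ_[3]),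
          (∀ x, ((b x : 𝓞_ℂ_[3]) : ℂ_[3]) = algebraMap (PadicAlgCl 3) ℂ_[3] (padicCoeffIntegers.toPadicAlgCl D.ι x)) →
        ∀ (ΩK : ℂ) (Ωp : (𝓞_ℂ_[3])ˣ) (Q : PowerSeries 𝓞_ℂ_[3]), ΩK ≠ 0 →
          IsBDPLFunctionWtSigmaInt ι' 𝔭 κ γ D.g (W'.sigmaPlacesFinset 3 K) ΩK ((Ωp : 𝓞_ℂ_[3]) : ℂ_[3]) Q →
        ∀ [TopologicalSpace (PowerSeries (padicCoeffIntegers D.ι))]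
          [ContinuousSMul (PowerSeries (padicCoeffIntegers D.ι))
            (BigRepModule (padicCoeffIntegers D.ι) 3 (Cofree D.Δ.selfDualRep (padicCoeffField D.ι)))],
          Module.IsTorsion (PowerSeries (padicCoeffIntegers D.ι))
              (XBig κ (D.Δ.selfDualCofreeRepOver K) 𝔭' (↑(W'.sigmaPlacesFinset 3 K))) →
            ∃ e : ℕ, Ideal.span {(PowerSeries.C ((3 : ℕ) : 𝓞_ℂ_[3]) : PowerSeries 𝓞_ℂ_[3]) ^ e} *
                (XBig.charIdeal κ (D.Δ.selfDualCofreeRepOver K) 𝔭' (↑(W'.sigmaPlacesFinset 3 K))).map (PowerSeries.map b) ≤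
              Ideal.span {Q}) :
    Summit.BirchSwinnertonDyer.BirchSwinnertonDyer.Theses.UniversalToricDescent.TwinWanFrameAtThreeMultTresT := by
  intro W' _ _ N' _ K _ _ Dt' hmult hsurj hN' hK hH hodd hndvd κ hκ γ _ 𝔭 h𝔭 he hf 𝔭' h𝔭' hne ι' hι'
  -- (dec) from the très-ramifié binder
  have hdec : ∀ Q : (W'.baseChange ℚ_[3]).toAffine.Point, 3 • Q = 0 → Q = 0 :=
    twin_dec_of_forall_not_cube W' hmult (forall_not_exists_pow_of_nonsplit_or_not_dvd W' (Or.inr hndvd))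
  -- the odd-`p` member/frame statement's binders from ♭B′'s
  have hirr : Irr W' 3 := hasIrreducibleModPGaloisRep_of_hasSurjectiveModNGaloisRep W' 3 hsurj
  have hM : 3 ≤ N' / 3 := by
    have h11 := Pasten2024.eleven_le_level Dt'
    omega
  have hsplit : ((Ideal.span {((3 : ℕ) : ℤ)}).primesOver (𝓞 K)).ncard = 2 :=
    ncard_primesOver_eq_two_of_degreeOne hK.1 h𝔭 he hf
  -- (dec) for every member at depth `m ≥ 1`: `W′(ℚ₃)[3] = 0` + `K_𝔭′ → ℚ₃` + the congruence (b)
  have hN0 : W'.conductorNorm ℤ ≠ 0 := (W'.conductorNorm_pos_holds).ne'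
  haveI : NeZero (W'.conductorNorm ℤ / 3) :=
    ⟨(Nat.div_pos (Nat.le_of_dvd (Nat.pos_of_ne_zero hN0) (dvd_conductorNorm_of_mult hmult)) (by norm_num)).ne'⟩
  obtain ⟨heb, hfb⟩ := degreeOne_of_splitsIn hK.1 hsplit h𝔭'
  obtain ⟨φ⟩ := AcSelmer.exists_ringHom_adicCompletion_padic_of_degreeOne 3 𝔭' h𝔭' heb hfb
  have h0 := BigRep.hdec_geomPoints_of_padicTorsion W' 3 K 𝔭' φ hdec
  have hdecD : ∀ (m : ℕ), 1 ≤ m → ∀ (D : Skinner2016.HidaCongruentMember W' 3 m),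
      (2 * (((3 : ℕ) : ℤ) - 1) * ((3 : ℕ) : ℤ) ^ (m - 1)) ∣ D.k - 2 →
      ∀ a : Cofree D.Δ.selfDualRep (padicCoeffField D.ι),
        (∀ σ : LocalGroup K (Sum.inl 𝔭'), (D.Δ.selfDualCofreeRepOver K) (localMap K (Sum.inl 𝔭') σ) a = a) →
        (∃ j : ℕ, (3 : ℕ) ^ j • a = 0) → a = 0 := by
    intro m hm D hk
    haveI := D.moduleFree_coeffRing
    exact SelfDualTwist.forall_fixed_primary_eq_zero_selfDual D K hm hk
      (fun σ : absoluteGaloisGroup (𝔭'.adicCompletion K) => absGaloisRestrict K (𝔭'.adicCompletion K) σ) h0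
  obtain ⟨ΩK, Ωp, L, hΩK, hL, hmem⟩ := hC ι' W' K 𝔭 κ γ Dt'.isNewformOf hN' (by decide) hmult hM hirr hK hodd hH hsplit h𝔭 hι'
    hκ (R1.unrToCpInt 3) (toUnr 3) (R1.coe_unrToCpInt 3) (coe_toUnr 3)
  have hΩp' : (((Units.map (R1.unrToCpInt 3 : unrIntegers 3 →* 𝓞_ℂ_[3]) Ωp : (𝓞_ℂ_[3])ˣ) : 𝓞_ℂ_[3]) : ℂ_[3]) =
      ((Ωp : unrIntegers 3) : ℂ_[3]) := by
    rw [Units.coe_map, MonoidHom.coe_coe, R1.coe_unrToCpInt]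
  have hΩp0 : ((Ωp : unrIntegers 3) : ℂ_[3]) ≠ 0 := fun h0 ↦
    Ωp.ne_zero ((ZeroMemClass.coe_eq_zero).mp h0)
  -- `μ(L) = 0` from Thm B (♭-witness moved across periods, p538896)
  have hμL : ∃ i : ℕ, IsUnit (PowerSeries.coeff i L) := by
    obtain ⟨ΩK₁, Ωp₁, Q, hΩK₁, hΩp₁, hQ, hμQ⟩ :=
      Summit.BirchSwinnertonDyer.BirchSwinnertonDyer.Theorems.UniversalToricDescentSelfMuZero.self_exists_isBDPLFunctionInt_coeff_norm_eq_one
        hB W' N' K Dt' hsurj hK hH κ hκ γ 𝔭 h𝔭 he hf ι' hι'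
    have hΩp₁0 : Ωp₁ ≠ 0 := fun h ↦ by rw [h, norm_zero] at hΩp₁; exact zero_ne_one hΩp₁
    obtain ⟨i, hi⟩ :=
      Summit.BirchSwinnertonDyer.BirchSwinnertonDyer.Theorems.UniversalToricDescentFlatMuTransfer.exists_coeff_norm_eq_one_of_isBDPLFunctionInt_of_isBDPLFunction
        hK hκ Fact.out hΩK₁ hΩK hΩp₁0 hΩp0 hQ hL hμQ
    exact ⟨i, (unrIntegers.isUnit_iff_norm_eq_one _).mpr hi⟩
  refine ⟨ΩK, ((Ωp : unrIntegers 3) : ℂ_[3]), L, hΩK, hΩp0, hL, fun hT₀ ↦ ?_⟩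
  refine twin_exists_forall_C_pow_mul_mem_span_of_cpIntMemberTower_selfDual_of_isTorsion
    SkinnerUrban2014.prop323_XAc_equiv_XBigDecomp_holds W' N' K hmult hsurj hN' hK hH κ hκ γ 𝔭' h𝔭' hdec hT₀ L hμL
    fun m hm ↦ ?_
  exact (hmem m hm).elim fun D hD ↦ hD.elim fun Qm hQ ↦
    ⟨D, Qm, hQ.1, fun b hb hT ↦ hK1 W' N' K Dt' hmult hsurj hN' hK hH hodd κ hκ γ 𝔭 h𝔭 he hf 𝔭' h𝔭' hne ι' hι' m hm D hQ.1
      hQ.2.2.1 (hdecD m hm D hQ.1) hQ.2.1 b hb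
      ΩK (Units.map (R1.unrToCpInt 3 : unrIntegers 3 →* 𝓞_ℂ_[3]) Ωp) Qm hΩK (hΩp' ▸ hQ.2.2.2.1) hT, hQ.2.2.2.2⟩

/-! ## §3† ♭B′ from the line's two Literature facts (Hsieh Thm B 20711, supply† 23284) and the two-variable core TV₃† -/

set_option maxHeartbeats 400000 in
/-- **♭B′ `TwinWanFrameAtThreeMultTresT` BY NAME from Hsieh Thm B (item 20711), the weight-sharpened supply
`Castella2018.castella2020_thm211_members_frames_sigma_congruence_odd_nonsplit_wt` (item 23284) and the TWO-VARIABLE CORE TV₃† on the self-dual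
module** — §2† ∘ (lead utd-p2 g18's `…AllSplitSelfDual.allSplitWtMembersFrames_of_nonsplitWtMembersFrames`) ∘ §1†: the composition of a skeleton
`membertower` v16 = {`stub_thmB`, `stub_pubMembersFramesCongruence` := 23284's fact, `stub_twoVarCoreAtThreeDagger` := TV₃†}. CONDITIONAL on
{PUBLISHED, PUBLISHED, TV₃† RESEARCH}; nothing is booked; BSD is proved for no curve. [cite: Hsieh2014, Thm. B p. 712] [cite: Castella2020JIMJ, §2 Thm. 2.11]
[cite: Skinner2016PacificMC, §2.6, §3.1 (a)(b)] [cite: JetchevSkinnerWan2017, §3.4, Cor. 3.4.2] [cite: Castella2018Erratum, §2 (p. 2), proof of Thm. 1.1 (a)(b)(c)] -/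
theorem twinWanFrameAtThreeMultTresT_of_thmB_of_nonsplitWtMembersFrames_of_twoVarCoreAtThreeDagger
    (hB : Hsieh2014.thmB_exists_isHsiehLFunction_coeff_norm_eq_one_unrPeriod_anyLevel)
    (hC' : Castella2018.castella2020_thm211_members_frames_sigma_congruence_odd_nonsplit_wt)
    (hTV :
    ∀ (W' : WeierstrassCurve ℚ) [W'.IsElliptic] [W'.IsGloballyMinimal] (N' : ℕ) [NeZero N']
      (K : Type) [Field K] [NumberField K] (Dt' : ModularParametrizationData W' N'),
      Mult W' 3 → W'.HasSurjectiveModNGaloisRep 3 → W'.conductorNorm ℤ = N' → IsImaginaryQuadratic K →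
      SatisfiesHeegnerHypothesis N' K → Odd (NumberField.discr K) →
      ∀ (κ : ZpExtension K 3), κ.IsAnticyclotomic → ∀ (γ : absoluteGaloisGroup K) [Fact (κ.IsTopGenerator γ)]
        (𝔭 : HeightOneSpectrum (𝓞 K)), ((3 : ℕ) : 𝓞 K) ∈ 𝔭.asIdeal →
        𝔭.asIdeal.ramificationIdx (𝓞 ℚ) = 1 → 𝔭.asIdeal.inertiaDeg (𝓞 ℚ) = 1 →
        ∀ (𝔭' : HeightOneSpectrum (𝓞 K)), ((3 : ℕ) : 𝓞 K) ∈ 𝔭'.asIdeal → 𝔭' ≠ 𝔭 →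
        ∀ (ι' : PadicAlgCl 3 ≃+* ℂ), BranchInducesPrime 3 ι' 𝔭 →
        ∀ (m : ℕ), 1 ≤ m → ∀ (D : Skinner2016.HidaCongruentMember W' 3 m),
          (2 * (((3 : ℕ) : ℤ) - 1) * ((3 : ℕ) : ℤ) ^ (m - 1)) ∣ D.k - 2 →
          SkinnerUrban2014.IsResiduallyIrreducible D.Δ →
          (∀ a : Cofree D.Δ.selfDualRep (padicCoeffField D.ι),
              (∀ σ : LocalGroup K (Sum.inl 𝔭'), (D.Δ.selfDualCofreeRepOver K) (localMap K (Sum.inl 𝔭') σ) a = a) →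
              (∃ j : ℕ, (3 : ℕ) ^ j • a = 0) → a = 0) →
          (∀ x : coeffField D.g, ι' (D.ι x) = (x : ℂ)) →
        ∀ (b : padicCoeffIntegers D.ι →+* 𝓞_ℂ_[3]),
          (∀ x, ((b x : 𝓞_ℂ_[3]) : ℂ_[3]) = algebraMap (PadicAlgCl 3) ℂ_[3] (padicCoeffIntegers.toPadicAlgCl D.ι x)) →
        ∀ (ΩK : ℂ) (Ωp : (𝓞_ℂ_[3])ˣ) (Q : PowerSeries 𝓞_ℂ_[3]), ΩK ≠ 0 →
          IsBDPLFunctionWtSigmaInt ι' 𝔭 κ γ D.g (W'.sigmaPlacesFinset 3 K) ΩK ((Ωp : 𝓞_ℂ_[3]) : ℂ_[3]) Q →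
        ∀ (κ' : ZpExtension K 3) (γ' : absoluteGaloisGroup K) [Fact (κ'.IsTopGenerator γ')], κ'.IsCyclotomic →
        ∀ [TopologicalSpace (PowerSeries (padicCoeffIntegers D.ι))]
          [TopologicalSpace (PowerSeries (PowerSeries (padicCoeffIntegers D.ι)))]
          [ContinuousSMul (PowerSeries (PowerSeries (padicCoeffIntegers D.ι)))
            (BigRepModule (PowerSeries (padicCoeffIntegers D.ι)) 3
              (BigRepModule (padicCoeffIntegers D.ι) 3 (Cofree D.Δ.selfDualRep (padicCoeffField D.ι))))],
          Module.IsTorsion (PowerSeries (PowerSeries (padicCoeffIntegers D.ι)))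
              (XBig κ' (AnticyclotomicBigGaloisRep κ (D.Δ.selfDualCofreeRepOver K)) 𝔭' (↑(W'.sigmaPlacesFinset 3 K))) →
            ∃ Q₂ : PowerSeries (PowerSeries 𝓞_ℂ_[3]),
              (∃ u : (PowerSeries 𝓞_ℂ_[3])ˣ, PowerSeries.constantCoeff Q₂ = (u : PowerSeries 𝓞_ℂ_[3]) * Q) ∧
              (XBig.charIdeal κ' (AnticyclotomicBigGaloisRep κ (D.Δ.selfDualCofreeRepOver K)) 𝔭'
                  (↑(W'.sigmaPlacesFinset 3 K))).map (PowerSeries.map (PowerSeries.map b)) ≤ Ideal.span {Q₂}) :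
    Summit.BirchSwinnertonDyer.BirchSwinnertonDyer.Theses.UniversalToricDescent.TwinWanFrameAtThreeMultTresT :=
  twinWanFrameAtThreeMultTresT_of_thmB_of_allSplitMembersFramesWt_of_decSelfDualMemberRationalInclusion hB
    (UniversalToricDescentTwinWanFrameAtThreeMultTresTAllSplitSelfDual.allSplitWtMembersFrames_of_nonsplitWtMembersFrames hC')
    (sharpDecDagger_of_twoVarCoreAtThreeDagger hTV)

end Summit.BirchSwinnertonDyer.BirchSwinnertonDyer.Theorems.UniversalToricDescentTwinMemberRationalInclusionAtThreeOfTwoVarCoreSelfDual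

end
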